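import Summits.ABC.IUTFork.ForkPacketHullContent
import Literature.IUT.LogVolume.TensorPacketContentVolume
import HarnessLib

/-!
# The Θ-hull volume at one REAL summand: the two-sided VOLUME-FORM window and the R0 threshold
# (sequel to XXVI `ForkPacketReal` / `ForkPacketHullContent`; [IUTchIV] Prop. 1.4 (iii); Dupuy–Hilado §4.9–4.12)

Record-only companion (abc-iut cell, prover seat abc-iut-w5-d082, item XXVIIc of `HOME/skel/FORK-REAL-MODEL.md` §4)
to the skeleton seat's XXVI (`ForkPacketReal`, p417081: the Step (v) UPPER bound `thetaHull_bound` and the failure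
of the summand readings at deep places) and to abc-iut-w5-d180's `ForkPacketHullContent` (p420914: the EXACT formula
`log μ̄(Θ-hull at v⃗) = −m·log p + H`, `m` the content of the (Ind1)-union of the sharp (Ind3)-data w.r.t.
`Λ = log_p(R_I^×)`, `H = log μ̄(hull(Λ))`). HERE, at XXVI's own objects (`orbit`, `thetaHull`, `pilotRegion`,
`VolumeReading`, …) and under the SAME sharp-(Ind3) hypotheses `hB`/`hB1` as `thetaHull_bound`, the content is
bracketed by VOLUMES (`Literature.IUT.LogVolume.TensorPacketContentVolume`):

* `logμ_thetaHull_ge_defect`: **`log‖t_{v_j}‖ + δ_Λ ≤ log μ̄(Θ-hull at v⃗)`**, `δ_Λ := H − log μ̄(Λ) ≥ 0` the hull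
  defect of the log-shell lattice of the summand — the trivial bound "the bare Θ-region lies in its hull"
  improved by exactly `δ_Λ` (and dominating the sandwich lower end `log‖t‖ − b_I·log p + H`, since `H ≤ b_I·log p`);
* `logμ_thetaHull_le_first`: **`log μ̄(Θ-hull at v⃗) ≤ log‖t_{v_{i₀}}‖ + δ_Λ + {d_I + 1 + 4|I*|/p}·log p`** — Step (v)
  in the currency of the FIRST displayed inequality of [IUTchIV] Prop. 1.4 (iii) (`Prop14iii₁_holds`), to be read
  next to XXVI's second-inequality form `log‖t_{v_{i₀}}‖ + {d_I + 1}·log p + Σ_{i∈I*}{3 + log e_i}`;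
* `logμ_thetaHull_window`: so at a summand the Θ-hull volume is pinned to a window of width
  `{λ_j − λ_min + d_I + 1 + 4|I*|/p}·log p` sitting at `log‖t_{v_j}‖ + δ_Λ` — no `a_I`, `b_I`;
* at the DIAGONAL summand `(v,…,v)` with the printed Θ-weights `‖t_v‖ = ‖q̲‖^{j²}`: R0 HOLDS as soon as
  `(j² − 1)·(−log‖q̲‖) ≤ δ_Λ` (`volumeReading_thetaWeights_of_le_defect`) and FAILS — with R2, R3, R4, R4′ — as soon as
  `(j² − 1)·(−log‖q̲‖) > δ_Λ + {d_I + 1 + 4|I*|/p}·log p` (`readings_fail_thetaWeights_of_gt`; `I* =` all slots gives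
  `4(j+1)/p`, all slots tame gives `I* = ∅`): XXVI's one-sided threshold `not_volumeReading_thetaWeights` becomes two-sided
  up to `{d_I + 1 + 4|I*|/p}·log p`, the exact threshold being `−m·log p + H − log‖q̲‖ ≥ 0` (w5-d180's formula);
* `readings_fail_of_not_volumeReading`: at any summand, ¬R0 alone already refutes R2, R3, R4, R4′ (monotonicity and
  (Ind2)-invariance of `log μ̄`; the Θ-hull is admissible for every sharp datum by `ForkPacketHullContent`).

HONEST SCOPE, as in XXVI: summand level (= the `(j,p)`-packet when `𝕍` has one place over `p`), sharp (Ind3),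
nothing about the GLOBAL `Cor312.Setting.Statement`; (Ind2)/hull/orbit are the tree's typings of disputed-corpus
constructions [claim: Mochizuki2012, status: disputed]; the volume algebra is classical
[cite: Mochizuki2012, IUTchIV Prop. 1.4 (iii) p. 13] [cite: DupuyHilado2025, §4.7, §4.9, §4.12]. typed ≠ proved; no
side taken on [IUTchIII] Cor. 3.12. PROOF-ONLY file: no definitions, no named `Prop` facts.
-/

noncomputable section

open Set Literature.IUT.LogVolume
open scoped Pointwise

namespace Summit.ABC.IUTFork.PacketReal

variable {F : Type} [Field F] [NumberField F]
variable (p : ℕ) [Fact p.Prime] (𝔽 : LocalFields F p)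

/-! ## 1. The (Ind1)-union sits between the bare Θ-region and the slot-union -/

/-- The bare Θ-region `t_{v_j}·O_{v⃗} = ι_j(t_{v_j})·(R_I)^∼` lies in the (Ind1)-union of the sharp data (at `σ = 1`,
by `hB1`). [cite: DupuyHilado2025, §3.9, §4.7] -/
theorem bare_subset_indOneUnion {j : ℕ} (e : Fin (j + 1) → placesOver F p)
    (t : ∀ v : placesOver F p, (𝔽.k v)ˣ) (B : (realPrimePacket p 𝔽).Region)
    (hB1 : pilotRegion p 𝔽 e (t (e (Fin.last j))) ⊆ B j e) :
    iota p (fun i => 𝔽.k (e i)) (Fin.last j) (t (e (Fin.last j)) : 𝔽.k (e (Fin.last j))) •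
        (normalizedPacket p (fun i => 𝔽.k (e i)) : Set (PacketAlgebra p (fun i => 𝔽.k (e i)))) ⊆
      ⋃ σ : Equiv.Perm (Fin (j + 1)), (realPrimePacket p 𝔽).perm σ e '' B j (e ∘ σ) := by
  have h1 : pilotRegion p 𝔽 e (t (e (Fin.last j))) =
      iota p (fun i => 𝔽.k (e i)) (Fin.last j) (t (e (Fin.last j)) : 𝔽.k (e (Fin.last j))) •
        (normalizedPacket p (fun i => 𝔽.k (e i)) : Set (PacketAlgebra p (fun i => 𝔽.k (e i)))) :=
    realPrimePacket_peel_image p 𝔽 (t (e (Fin.last j))) _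
  rw [← h1]
  refine hB1.trans fun x hx => Set.mem_iUnion.mpr ⟨1, ?_⟩
  exact ⟨x, hx, (realPrimePacket p 𝔽).perm_one e x⟩

/-- The (Ind1)-union of the sharp data lies in the slot-union `⋃_i ι_i(t_{v_i})·(R_I)^∼` (`perm_σ(t·O_{v⃗∘σ}) =
ι_{σ(j)}(t)·(R_I)^∼`, by `hB`). [cite: DupuyHilado2025, §3.9, §4.7] -/
theorem indOneUnion_subset_slotUnion {j : ℕ} (e : Fin (j + 1) → placesOver F p)
    (t : ∀ v : placesOver F p, (𝔽.k v)ˣ) (B : (realPrimePacket p 𝔽).Region)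
    (hB : ∀ σ : Equiv.Perm (Fin (j + 1)), B j (e ∘ σ) ⊆ pilotRegion p 𝔽 (e ∘ σ) (t (e (σ (Fin.last j))))) :
    (⋃ σ : Equiv.Perm (Fin (j + 1)), (realPrimePacket p 𝔽).perm σ e '' B j (e ∘ σ)) ⊆
      ⋃ i : Fin (j + 1), iota p (fun i => 𝔽.k (e i)) i (t (e i) : 𝔽.k (e i)) •
        (normalizedPacket p (fun i => 𝔽.k (e i)) : Set (PacketAlgebra p (fun i => 𝔽.k (e i)))) := by
  refine Set.iUnion_subset fun σ => ?_
  have h1 : (realPrimePacket p 𝔽).perm σ e '' B j (e ∘ σ) ⊆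
      iota p (fun i => 𝔽.k (e i)) (σ (Fin.last j)) (t (e (σ (Fin.last j))) : _) •
        (normalizedPacket p (fun i => 𝔽.k (e i)) : Set (PacketAlgebra p (fun i => 𝔽.k (e i)))) := by
    rw [← realPrimePacket_perm_image_bare p 𝔽 σ e (t (e (σ (Fin.last j))))]
    exact Set.image_mono (hB σ)
  exact h1.trans (Set.subset_iUnion (fun i : Fin (j + 1) => iota p (fun i => 𝔽.k (e i)) i (t (e i) : 𝔽.k (e i)) •
    (normalizedPacket p (fun i => 𝔽.k (e i)) : Set (PacketAlgebra p (fun i => 𝔽.k (e i))))) (σ (Fin.last j)))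

/-! ## 2. The lower end: the bare bound improved by the hull defect -/

/-- **`log‖t_{v_j}‖ + δ_Λ ≤ log μ̄(Θ-hull at v⃗)`** for every sharp (Ind3)-datum around `t` (`hB`, `hB1` as in XXVI's
`thetaHull_bound`), where `δ_Λ = log μ̄(hull(log_p(R_I^×))) − log μ̄(log_p(R_I^×)) ≥ 0` is the hull defect of the
log-shell lattice of the summand: the content `m` of the (Ind1)-union obeys `m·log p ≤ −log‖t_{v_j}‖ + log μ̄(Λ)`
(the bare region lies in `p^m·Λ`; compare volumes) in w5-d180's `log μ̄(Θ-hull) = −m·log p + H`.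
[cite: DupuyHilado2025, §4.9, §4.12] -/
theorem logμ_thetaHull_ge_defect {j : ℕ} (e : Fin (j + 1) → placesOver F p)
    (t : ∀ v : placesOver F p, (𝔽.k v)ˣ) (B : (realPrimePacket p 𝔽).Region)
    (hB : ∀ σ : Equiv.Perm (Fin (j + 1)), B j (e ∘ σ) ⊆ pilotRegion p 𝔽 (e ∘ σ) (t (e (σ (Fin.last j)))))
    (hB1 : pilotRegion p 𝔽 e (t (e (Fin.last j))) ⊆ B j e) :
    Real.log ‖(t (e (Fin.last j)) : 𝔽.k (e (Fin.last j)))‖ +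
        (packetLogμ p (fun i => 𝔽.k (e i))
            (packetHull p (fun i => 𝔽.k (e i)) (logPacket p (fun i => 𝔽.k (e i)) : Set _)) -
          packetLogμ p (fun i => 𝔽.k (e i)) (logPacket p (fun i => 𝔽.k (e i)) : Set _)) ≤
      (realPrimePacket p 𝔽).logμ (thetaHull p 𝔽 e B) := by
  haveI : Nonempty (Fin (j + 1)) := ⟨0⟩
  obtain ⟨m, hm, -, -, -, hvol⟩ := thetaHull_eq_packetHull_zpow_logPacket p 𝔽 e t B hB hB1
  have hc := content_mul_log_le_of_smul_subset p (fun i => 𝔽.k (e i)) (t (e (Fin.last j))).ne_zero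
    ((bare_subset_indOneUnion p 𝔽 e t B hB1).trans hm)
  rw [hvol]
  linarith

/-- In particular the bare bound `log‖t_{v_j}‖ ≤ log μ̄(Θ-hull at v⃗)` (`δ_Λ ≥ 0`). [cite: DupuyHilado2025, §4.12] -/
theorem log_norm_le_logμ_thetaHull {j : ℕ} (e : Fin (j + 1) → placesOver F p)
    (t : ∀ v : placesOver F p, (𝔽.k v)ˣ) (B : (realPrimePacket p 𝔽).Region)
    (hB : ∀ σ : Equiv.Perm (Fin (j + 1)), B j (e ∘ σ) ⊆ pilotRegion p 𝔽 (e ∘ σ) (t (e (σ (Fin.last j)))))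
    (hB1 : pilotRegion p 𝔽 e (t (e (Fin.last j))) ⊆ B j e) :
    Real.log ‖(t (e (Fin.last j)) : 𝔽.k (e (Fin.last j)))‖ ≤ (realPrimePacket p 𝔽).logμ (thetaHull p 𝔽 e B) := by
  haveI : Nonempty (Fin (j + 1)) := ⟨0⟩
  have h1 := logμ_thetaHull_ge_defect p 𝔽 e t B hB hB1
  have h2 := packetLogμ_logPacket_le_packetHull p (fun i => 𝔽.k (e i))
  linarith

/-! ## 3. The upper end in the first-inequality currency, and the window -/

/-- **`log μ̄(Θ-hull at v⃗) ≤ log‖t_{v_{i₀}}‖ + δ_Λ + {d_I + 1 + 4|I*|/p}·log p`** (`j ≥ 1`, `I* ⊇` the non-tame slots,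
`i₀` a slot of largest norm): Step (v) per summand in the currency of the FIRST inequality of [IUTchIV] Prop. 1.4
(iii) — the content lower bound `⌊λ_min − d_I − a_I⌋ ≤ m` read through `log μ̄(Θ-hull) = −m·log p + H` and
`log μ̄(p^{⌊λ−d_I−a_I⌋}·Λ) ≤ {−λ + d_I + 1 + 4|I*|/p}·log p`.
[cite: Mochizuki2012, IUTchIV Prop. 1.4 (iii) p. 13, Thm 1.10 proof Step (v) p. 27–28] -/
theorem logμ_thetaHull_le_first {j : ℕ} (hj : 1 ≤ j) (e : Fin (j + 1) → placesOver F p)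
    (t : ∀ v : placesOver F p, (𝔽.k v)ˣ) (B : (realPrimePacket p 𝔽).Region)
    (hB : ∀ σ : Equiv.Perm (Fin (j + 1)), B j (e ∘ σ) ⊆ pilotRegion p 𝔽 (e ∘ σ) (t (e (σ (Fin.last j)))))
    (hB1 : pilotRegion p 𝔽 e (t (e (Fin.last j))) ⊆ B j e)
    (Istar : Finset (Fin (j + 1))) (htame : ∀ i, i ∉ Istar → absRamificationIdx p (𝔽.k (e i)) ≤ p - 2)
    (i₀ : Fin (j + 1)) (hmax : ∀ i, ‖(t (e i) : 𝔽.k (e i))‖ ≤ ‖(t (e i₀) : 𝔽.k (e i₀))‖) :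
    (realPrimePacket p 𝔽).logμ (thetaHull p 𝔽 e B) ≤
      Real.log ‖(t (e i₀) : 𝔽.k (e i₀))‖ +
        (packetLogμ p (fun i => 𝔽.k (e i))
            (packetHull p (fun i => 𝔽.k (e i)) (logPacket p (fun i => 𝔽.k (e i)) : Set _)) -
          packetLogμ p (fun i => 𝔽.k (e i)) (logPacket p (fun i => 𝔽.k (e i)) : Set _)) +
        (dSum p (fun i => 𝔽.k (e i)) + 1 + 4 * (Istar.card : ℝ) / p) * Real.log p := by
  haveI : Nonempty (Fin (j + 1)) := ⟨0⟩
  have hI : 2 ≤ Fintype.card (Fin (j + 1)) := by rw [Fintype.card_fin]; omega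
  have ht0 : ∀ i, (t (e i) : (fun i => 𝔽.k (e i)) i) ≠ 0 := fun i => (t (e i)).ne_zero
  choose mexp hm using fun i => exists_norm_eq_rpow p ((fun i => 𝔽.k (e i)) i) (ht0 i)
  have hmin : ∀ i, (mexp i₀ : ℝ) / absRamificationIdx p ((fun i => 𝔽.k (e i)) i₀) ≤
      (mexp i : ℝ) / absRamificationIdx p ((fun i => 𝔽.k (e i)) i) :=
    fun i => slotOrder_le_of_norm_le p (fun i => 𝔽.k (e i)) (hm i) (hm i₀) (hmax i)
  have hMb := isPsiBounded_indOneUnion p 𝔽 e t B hB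
  have hM0 := exists_ne_zero_mem_indOneUnion p 𝔽 e t B hB1
  have hMU := indOneUnion_subset_slotUnion p 𝔽 e t B hB
  have hup := packetLogμ_packetHull_orbit_le_first' p (fun i => 𝔽.k (e i)) hI Istar htame hMb hM0
    (fun i => (t (e i) : 𝔽.k (e i))) mexp hm i₀ hmin hMU
  have hhull : (realPrimePacket p 𝔽).logμ (thetaHull p 𝔽 e B) = packetLogμ p (fun i => 𝔽.k (e i))
      (packetHull p (fun i => 𝔽.k (e i)) (⋃ γ : indTwo p (fun i => 𝔽.k (e i)),
        γ • (⋃ σ : Equiv.Perm (Fin (j + 1)), (realPrimePacket p 𝔽).perm σ e '' B j (e ∘ σ) :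
          Set (PacketAlgebra p (fun i => 𝔽.k (e i)))))) := by
    change packetLogμ p (fun i => 𝔽.k (e i)) (packetHull p (fun i => 𝔽.k (e i)) (orbit p 𝔽 e B)) = _
    rw [orbit_eq_iUnion_smul]
    rfl
  rw [hhull]
  linarith

/-- **The volume-form window at a summand** (both ends together): for every sharp (Ind3)-datum around `t`,
`log‖t_{v_j}‖ + δ_Λ ≤ log μ̄(Θ-hull at v⃗) ≤ log‖t_{v_{i₀}}‖ + δ_Λ + {d_I + 1 + 4|I*|/p}·log p` — a window of width
`{log‖t_{v_{i₀}}‖ − log‖t_{v_j}‖} + {d_I + 1 + 4|I*|/p}·log p` sitting at the packet invariant `δ_Λ`; at a summand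
with slot-constant orders (e.g. the diagonal) the width is `{d_I + 1 + 4|I*|/p}·log p`.
[cite: Mochizuki2012, IUTchIV Prop. 1.4 (iii) p. 13] [cite: DupuyHilado2025, §4.9, §4.12] -/
theorem logμ_thetaHull_window {j : ℕ} (hj : 1 ≤ j) (e : Fin (j + 1) → placesOver F p)
    (t : ∀ v : placesOver F p, (𝔽.k v)ˣ) (B : (realPrimePacket p 𝔽).Region)
    (hB : ∀ σ : Equiv.Perm (Fin (j + 1)), B j (e ∘ σ) ⊆ pilotRegion p 𝔽 (e ∘ σ) (t (e (σ (Fin.last j)))))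
    (hB1 : pilotRegion p 𝔽 e (t (e (Fin.last j))) ⊆ B j e)
    (Istar : Finset (Fin (j + 1))) (htame : ∀ i, i ∉ Istar → absRamificationIdx p (𝔽.k (e i)) ≤ p - 2)
    (i₀ : Fin (j + 1)) (hmax : ∀ i, ‖(t (e i) : 𝔽.k (e i))‖ ≤ ‖(t (e i₀) : 𝔽.k (e i₀))‖) :
    Real.log ‖(t (e (Fin.last j)) : 𝔽.k (e (Fin.last j)))‖ +
          (packetLogμ p (fun i => 𝔽.k (e i))
              (packetHull p (fun i => 𝔽.k (e i)) (logPacket p (fun i => 𝔽.k (e i)) : Set _)) -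
            packetLogμ p (fun i => 𝔽.k (e i)) (logPacket p (fun i => 𝔽.k (e i)) : Set _)) ≤
        (realPrimePacket p 𝔽).logμ (thetaHull p 𝔽 e B) ∧
      (realPrimePacket p 𝔽).logμ (thetaHull p 𝔽 e B) ≤
        Real.log ‖(t (e i₀) : 𝔽.k (e i₀))‖ +
          (packetLogμ p (fun i => 𝔽.k (e i))
              (packetHull p (fun i => 𝔽.k (e i)) (logPacket p (fun i => 𝔽.k (e i)) : Set _)) -
            packetLogμ p (fun i => 𝔽.k (e i)) (logPacket p (fun i => 𝔽.k (e i)) : Set _)) +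
          (dSum p (fun i => 𝔽.k (e i)) + 1 + 4 * (Istar.card : ℝ) / p) * Real.log p :=
  ⟨logμ_thetaHull_ge_defect p 𝔽 e t B hB hB1,
    logμ_thetaHull_le_first p 𝔽 hj e t B hB hB1 Istar htame i₀ hmax⟩

/-! ## 4. ¬R0 alone refutes the other summand readings -/

/-- **At any summand, for any sharp (Ind3)-datum: if the volume reading R0 fails then R2, R3, R4 and R4′ fail**
(R2 ⟹ R0 by monotonicity of `log μ̄` — the Θ-hull is admissible by `ForkPacketHullContent`; R3 ⟹ R2 as the orbit
lies in its hull; R4 ⟹ R4′ by (Ind2)-invariance of `log μ̄`; R4′ ⟹ R0 by monotonicity).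
[cite: DupuyHilado2025, §4.9, §4.12] [cite: Yamashita2024IUTSurvey, Cor. 13.13 proof p. 360] -/
theorem readings_fail_of_not_volumeReading {j : ℕ} (e : Fin (j + 1) → placesOver F p)
    (t : ∀ v : placesOver F p, (𝔽.k v)ˣ) (B : (realPrimePacket p 𝔽).Region)
    (hB : ∀ σ : Equiv.Perm (Fin (j + 1)), B j (e ∘ σ) ⊆ pilotRegion p 𝔽 (e ∘ σ) (t (e (σ (Fin.last j)))))
    (hB1 : pilotRegion p 𝔽 e (t (e (Fin.last j))) ⊆ B j e) (q : (𝔽.k (e (Fin.last j)))ˣ)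
    (h : ¬ VolumeReading p 𝔽 e q B) :
    ¬ SubsetReading p 𝔽 e q B ∧ ¬ MemReading p 𝔽 e q B ∧ ¬ IsoReading p 𝔽 e q B ∧ ¬ IsoVolReading p 𝔽 e q B := by
  obtain ⟨-, -, -, -, hadm, -⟩ := thetaHull_eq_packetHull_zpow_logPacket p 𝔽 e t B hB hB1
  have h2 : ¬ SubsetReading p 𝔽 e q B := fun hs =>
    h ((realPrimePacket p 𝔽).logμ_mono (adm_pilotRegion p 𝔽 e q) hadm hs)
  have h4' : ¬ IsoVolReading p 𝔽 e q B := by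
    rintro ⟨R, hR, hRadm, hvol⟩
    refine h ?_
    unfold VolumeReading
    rw [← hvol]
    exact (realPrimePacket p 𝔽).logμ_mono hRadm hadm hR
  exact ⟨h2, fun h3 => h2 (h3.trans (orbit_subset_thetaHull p 𝔽 e B)),
    fun h4 => h4' (isoVolReading_of_isoReading p 𝔽 h4), h4'⟩

/-! ## 5. The diagonal summand with the printed Θ-weights: R0's threshold is two-sided -/

section Diagonal

variable {p 𝔽}
variable {j : ℕ} (v : placesOver F p) (t : ∀ w : placesOver F p, (𝔽.k w)ˣ) (q : (𝔽.k v)ˣ)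
  (hθ : ‖(t v : 𝔽.k v)‖ = ‖(q : 𝔽.k v)‖ ^ (j ^ 2))
  (B : (realPrimePacket p 𝔽).Region)
  (hB : ∀ σ : Equiv.Perm (Fin (j + 1)),
    B j ((fun _ : Fin (j + 1) => v) ∘ σ) ⊆ pilotRegion p 𝔽 ((fun _ : Fin (j + 1) => v) ∘ σ) (t v))
  (hB1 : pilotRegion p 𝔽 (fun _ : Fin (j + 1) => v) (t v) ⊆ B j (fun _ => v))
include hθ hB hB1

/-- **R0 HOLDS at the diagonal summand as soon as `(j² − 1)·(−log‖q̲‖) ≤ δ_Λ`** (Θ-weights `‖t_v‖ = ‖q̲‖^{j²}`; every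
sharp (Ind3)-datum): then `log‖q̲‖ ≤ j²·log‖q̲‖ + δ_Λ ≤ log μ̄(Θ-hull)`. In particular R0 holds whenever `q̲` is a unit.
[cite: Mochizuki2012, IUTchIV Thm 1.10 proof Step (v) p. 27–28] [cite: DupuyHilado2025, §4.12] -/
theorem volumeReading_thetaWeights_of_le_defect
    (hle : ((j : ℝ) ^ 2 - 1) * (-Real.log ‖(q : 𝔽.k v)‖) ≤
      packetLogμ p (fun _ : Fin (j + 1) => 𝔽.k v)
          (packetHull p (fun _ : Fin (j + 1) => 𝔽.k v) (logPacket p (fun _ : Fin (j + 1) => 𝔽.k v) : Set _)) -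
        packetLogμ p (fun _ : Fin (j + 1) => 𝔽.k v) (logPacket p (fun _ : Fin (j + 1) => 𝔽.k v) : Set _)) :
    VolumeReading p 𝔽 (fun _ : Fin (j + 1) => v) q B := by
  have hlog : Real.log ‖(t v : 𝔽.k v)‖ = (j : ℝ) ^ 2 * Real.log ‖(q : 𝔽.k v)‖ := by
    rw [hθ, Real.log_pow]
    push_cast
    ring
  have h1 := logμ_thetaHull_ge_defect p 𝔽 (fun _ : Fin (j + 1) => v) t B hB hB1
  unfold VolumeReading
  rw [logμ_pilotRegion]
  rw [hlog] at h1
  linarith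

/-- **R0 FAILS — and with it R2, R3, R4, R4′ — at the diagonal summand as soon as
`(j² − 1)·(−log‖q̲‖) > δ_Λ + {d_I + 1 + 4|I*|/p}·log p`** (`j ≥ 1`, `I* ⊇` the non-tame slots; with `I* =` all slots the
constant is `{d_I + 1 + 4(j+1)/p}·log p`, with all slots tame and `I* = ∅` it is `{d_I + 1}·log p`): the first-inequality
form of XXVI's `not_volumeReading_thetaWeights`. Together with `volumeReading_thetaWeights_of_le_defect`: the exact R0
threshold for `(j² − 1)·(−log‖q̲‖)` at this summand lies in `[δ_Λ, δ_Λ + {d_I + 1 + 4|I*|/p}·log p]`.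
[cite: Mochizuki2012, IUTchIV Thm 1.10 proof Step (v) p. 27–28] -/
theorem readings_fail_thetaWeights_of_gt (hj : 1 ≤ j) (Istar : Finset (Fin (j + 1)))
    (htame : ∀ i, i ∉ Istar → absRamificationIdx p (𝔽.k v) ≤ p - 2)
    (hgt : packetLogμ p (fun _ : Fin (j + 1) => 𝔽.k v)
          (packetHull p (fun _ : Fin (j + 1) => 𝔽.k v) (logPacket p (fun _ : Fin (j + 1) => 𝔽.k v) : Set _)) -
        packetLogμ p (fun _ : Fin (j + 1) => 𝔽.k v) (logPacket p (fun _ : Fin (j + 1) => 𝔽.k v) : Set _) +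
        (dSum p (fun _ : Fin (j + 1) => 𝔽.k v) + 1 + 4 * (Istar.card : ℝ) / p) * Real.log p <
      ((j : ℝ) ^ 2 - 1) * (-Real.log ‖(q : 𝔽.k v)‖)) :
    ¬ VolumeReading p 𝔽 (fun _ : Fin (j + 1) => v) q B ∧
      ¬ SubsetReading p 𝔽 (fun _ : Fin (j + 1) => v) q B ∧
      ¬ MemReading p 𝔽 (fun _ : Fin (j + 1) => v) q B ∧
      ¬ IsoReading p 𝔽 (fun _ : Fin (j + 1) => v) q B ∧
      ¬ IsoVolReading p 𝔽 (fun _ : Fin (j + 1) => v) q B := by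
  have hlog : Real.log ‖(t v : 𝔽.k v)‖ = (j : ℝ) ^ 2 * Real.log ‖(q : 𝔽.k v)‖ := by
    rw [hθ, Real.log_pow]
    push_cast
    ring
  have hup := logμ_thetaHull_le_first p 𝔽 hj (fun _ : Fin (j + 1) => v) t B hB hB1 Istar htame (Fin.last j)
    (fun _ => le_rfl)
  rw [hlog] at hup
  have h0 : ¬ VolumeReading p 𝔽 (fun _ : Fin (j + 1) => v) q B := by
    intro h
    unfold VolumeReading at h
    rw [logμ_pilotRegion] at h
    linarith
  exact ⟨h0, readings_fail_of_not_volumeReading p 𝔽 (fun _ : Fin (j + 1) => v) t B hB hB1 q h0⟩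

end Diagonal

end Summit.ABC.IUTFork.PacketReal

end
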